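import Literature.MathematicalPhysics.QuantumLattice.DWaveSourceTorusPairWords
import Literature.MathematicalPhysics.QuantumLattice.PairWordConnectedCoeffBound
import Literature.MathematicalPhysics.QuantumLattice.DWaveSourceTorusSingleScalePressure
import HarnessLib

/-!
# The line bound for the word propagator matrices of the sourced Hubbard torus letters

Topic `MathematicalPhysics/QuantumLattice`; the hypothesis `hG` of `PairWordSingleScalePressure` for the
letters of `DWaveSourceTorusPairWords` (Hartree, on-site and source bond letters, two pairs each): if the
thermal kernel of a Hermitian one-body operator `K` on the orbitals of the torus obeys
`‖Γ_K(τ)_{(w,σ'),(u,σ)}‖ ≤ C'(1+|w̄-ū|_L)^{-4}` for `τ ∈ [0, β]`, then for simplex times, every type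
pattern `t⃗`, letter sites `g` and pairs `a, b`,

`‖G_{(t⃗,g)}(a, b)‖ ≤ 81 C' (1 + |ḡ_{v(a)} - ḡ_{v(b)}|_L)^{-4}`

(`norm_wordPropMatrix_dws_apply_le`): the entries are thermal kernels between an annihilation orbital of
letter `v(b)` and a creation orbital of letter `v(a)` (`fermiKernel_creationFirst_eq` /
`fermiKernel_annihilationFirst_eq`), each within torus distance `1` of its letter's site
(`tnorm_dwsOp_sub_le`, `tnorm_dwsOm_sub_le`), and `(1+|u+d|)^{-4} ≤ 81(1+|u|)^{-4}` for `|d| ≤ 2`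
(`inv_pow_four_le_of_near`). Everything is PROVED; no definition and no named fact.

## References
* G. Benfatto, A. Giuliani, V. Mastropietro, Ann. Henri Poincaré 7 (2006) 809–898, §2.2.
  [cite: BenfattoGiulianiMastropietro2006, §2.2 (2.13)]
-/

noncomputable section

open scoped Matrix.Norms.L2Operator ComplexOrder
open Finset MeasureTheory Filter Topology NormedSpace Set
open Literature.Probability.LatticeModels

namespace Literature.MathematicalPhysics.QuantumLattice

-- the generic `DecidableEq` path on `Orb (FermionTorus 2 L)` (cf. `ShibaFreeThermalKernel`)
attribute [-instance] instDecidableEqLex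

section LineBound

variable {L : ℕ} [NeZero L]

/-- **Shift tolerance of the decay weight**: if `A`, `B` are within torus distance `1` of `Ga`, `Gb`,
then `C'(1+|B-A|_L)^{-4} ≤ 81 C'(1+|Ga-Gb|_L)^{-4}`. [folklore] -/
theorem inv_pow_four_le_of_near {A B Ga Gb : TorusSite 2 L} (ha : Torus.tnorm (A - Ga) ≤ 1)
    (hb : Torus.tnorm (B - Gb) ≤ 1) {C' : ℝ} (hC' : 0 ≤ C') :
    C' * ((1 + (Torus.tnorm (B - A) : ℝ)) ^ 4)⁻¹ ≤
      81 * C' * ((1 + (Torus.tnorm (Ga - Gb) : ℝ)) ^ 4)⁻¹ := by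
  have h1 : Torus.tnorm (Ga - Gb) ≤ Torus.tnorm (B - A) + 2 := by
    have hdec : Ga - Gb = -(A - Ga) + (-(B - A) + (B - Gb)) := by abel
    rw [hdec]
    calc Torus.tnorm (-(A - Ga) + (-(B - A) + (B - Gb)))
        ≤ Torus.tnorm (-(A - Ga)) + Torus.tnorm (-(B - A) + (B - Gb)) := Torus.tnorm_add_le _ _
      _ ≤ Torus.tnorm (-(A - Ga)) + (Torus.tnorm (-(B - A)) + Torus.tnorm (B - Gb)) :=
          Nat.add_le_add_left (Torus.tnorm_add_le _ _) _
      _ ≤ Torus.tnorm (A - Ga) + (Torus.tnorm (B - A) + Torus.tnorm (B - Gb)) :=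
          Nat.add_le_add (Torus.tnorm_neg_le _) (Nat.add_le_add_right (Torus.tnorm_neg_le _) _)
      _ ≤ Torus.tnorm (B - A) + 2 := by omega
  have h1R : (Torus.tnorm (Ga - Gb) : ℝ) ≤ (Torus.tnorm (B - A) : ℝ) + 2 := by exact_mod_cast h1
  set m : ℝ := (Torus.tnorm (B - A) : ℝ) with hm
  set n : ℝ := (Torus.tnorm (Ga - Gb) : ℝ) with hn
  have hm0 : 0 ≤ m := by positivity
  have hn0 : 0 ≤ n := by positivity
  have h3 : 1 + n ≤ 3 * (1 + m) := by linarith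
  have h4 : (1 + n) ^ 4 ≤ (3 * (1 + m)) ^ 4 := pow_le_pow_left₀ (by positivity) h3 4
  have hpos : 0 < (1 + n) ^ 4 := by positivity
  calc C' * ((1 + m) ^ 4)⁻¹ = 81 * C' * ((3 * (1 + m)) ^ 4)⁻¹ := by
        rw [mul_pow]; norm_num; ring
    _ ≤ 81 * C' * ((1 + n) ^ 4)⁻¹ := by
        refine mul_le_mul_of_nonneg_left ?_ (by positivity)
        exact inv_anti₀ hpos h4

omit [NeZero L] in
/-- An orbital is `orb` of its site and spin. [folklore] -/
theorem orb_ofLex_eta (o : Orb (FermionTorus 2 L)) : orb (ofLex o).1 (ofLex o).2 = o := rfl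

variable (β : ℝ) {K : Matrix (Orb (FermionTorus 2 L)) (Orb (FermionTorus 2 L)) ℂ}

/-- **The line bound `hG` of the word expansion for the sourced-torus letters**: if the thermal kernel
of the Hermitian one-body operator `K` obeys `‖Γ_K(τ)_{(w,σ'),(u,σ)}‖ ≤ C'(1+|w̄-ū|_L)^{-4}` for all
`τ ∈ [0, β]`, then for monotone simplex times `v ∈ [0,1]^j`, a type pattern `t⃗`, letter sites `g` and
pairs `a, b`: `‖G_{(t⃗,g)}(-βv)(a, b)‖ ≤ 81 C'(1 + |ḡ_{v(a)} - ḡ_{v(b)}|_L)^{-4}`.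
[cite: BenfattoGiulianiMastropietro2006, §2.2 (2.13)] -/
theorem norm_wordPropMatrix_dws_apply_le (hβ : 0 ≤ β) (hK : K.IsHermitian) {C' : ℝ} (hC' : 0 ≤ C')
    (hΓ : ∀ τ ∈ Icc (0 : ℝ) β, ∀ (u w : FermionTorus 2 L) (σ σ' : Fin 2),
      ‖(exp ((-τ) • K) * (1 + exp ((-β) • K))⁻¹) (orb w σ') (orb u σ)‖ ≤
        C' * ((1 + (Torus.tnorm (FermionTorus.toTorusSite w - FermionTorus.toTorusSite u) : ℝ)) ^ 4)⁻¹)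
    {j : ℕ} (v : Fin j → ℝ) (hvm : Monotone v) (hv01 : ∀ i, v i ∈ Icc (0 : ℝ) 1)
    (t : Fin j → DwsType) (g : Fin j → FermionTorus 2 L) (a b : Fin (j * 2)) :
    ‖wordPropMatrix β K (dwsOp L) (dwsOm L) (fun i => (t i, g i)) (fun i => ((v i : ℝ) : ℂ) * -(β : ℂ)) a b‖ ≤
      81 * C' * ((1 + (Torus.tnorm (FermionTorus.toTorusSite (g (wordCluster 2 j a)) -
        FermionTorus.toTorusSite (g (wordCluster 2 j b))) : ℝ)) ^ 4)⁻¹ := by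
  obtain ⟨hanti, hwin⟩ := word_times_antitone_window (p := 2) (j := j) hβ hvm hv01
  -- the orbitals of the two pairs and their distance to the letters' sites
  set oa : Orb (FermionTorus 2 L) := dwsOp L (t (finProdFinEquiv.symm a).1, g (finProdFinEquiv.symm a).1)
    (finProdFinEquiv.symm a).2 with hoa
  set ob : Orb (FermionTorus 2 L) := dwsOm L (t (finProdFinEquiv.symm b).1, g (finProdFinEquiv.symm b).1)
    (finProdFinEquiv.symm b).2 with hob
  have hA : Torus.tnorm (FermionTorus.toTorusSite (ofLex oa).1 -
      FermionTorus.toTorusSite (g (finProdFinEquiv.symm a).1)) ≤ 1 :=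
    tnorm_dwsOp_sub_le L (t (finProdFinEquiv.symm a).1, g (finProdFinEquiv.symm a).1) _
  have hB : Torus.tnorm (FermionTorus.toTorusSite (ofLex ob).1 -
      FermionTorus.toTorusSite (g (finProdFinEquiv.symm b).1)) ≤ 1 :=
    tnorm_dwsOm_sub_le L (t (finProdFinEquiv.symm b).1, g (finProdFinEquiv.symm b).1) _
  have hshift := inv_pow_four_le_of_near (L := L) hA hB hC'
  -- the times are real: `t_p = v_{⌊p/2⌋} · (-β) ∈ [-β, 0]`, antitone in `p`
  have htime : ∀ i, ((v i : ℝ) : ℂ) * -(β : ℂ) = (((v i * -β : ℝ)) : ℂ) := fun i => by push_cast; ring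
  unfold wordPropMatrix propMatrix
  rw [Matrix.of_apply]
  simp only [htime]
  have ha := hwin a
  have hb := hwin b
  refine le_trans ?_ hshift
  by_cases hab : a ≤ b
  · -- creation-first: `Γ(β - (t_a - t_b))`, `t_a - t_b ∈ [0, β]`
    rw [if_pos hab, fermiKernel_creationFirst_eq hK]
    have hd : 0 ≤ v (finProdFinEquiv.symm a).1 * -β - v (finProdFinEquiv.symm b).1 * -β := by
      have := hanti hab; linarith
    have hτ : β - (v (finProdFinEquiv.symm a).1 * -β - v (finProdFinEquiv.symm b).1 * -β) ∈ Icc (0:ℝ) β :=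
      ⟨by linarith [ha.1, ha.2, hb.1, hb.2], by linarith⟩
    have key := hΓ _ hτ (ofLex oa).1 (ofLex ob).1 (ofLex oa).2 (ofLex ob).2
    rw [orb_ofLex_eta, orb_ofLex_eta] at key
    exact key
  · -- annihilation-first: `-Γ(t_b - t_a)`, `t_b - t_a ∈ [0, β]`
    rw [if_neg hab, norm_neg, fermiKernel_annihilationFirst_eq hK]
    have hlt : b ≤ a := le_of_not_ge hab
    have hd : 0 ≤ v (finProdFinEquiv.symm b).1 * -β - v (finProdFinEquiv.symm a).1 * -β := by
      have := hanti hlt; linarith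
    have hτ : v (finProdFinEquiv.symm b).1 * -β - v (finProdFinEquiv.symm a).1 * -β ∈ Icc (0:ℝ) β :=
      ⟨hd, by linarith [ha.1, ha.2, hb.1, hb.2]⟩
    have key := hΓ _ hτ (ofLex oa).1 (ofLex ob).1 (ofLex oa).2 (ofLex ob).2
    rw [orb_ofLex_eta, orb_ofLex_eta] at key
    exact key

end LineBound

end Literature.MathematicalPhysics.QuantumLattice
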